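import Mathlib
import Literature.Combinatorics.Optimization.KnapsackQuadraticSosDegree
import Literature.Combinatorics.Optimization.HypercubeSosUpperBounds
import HarnessLib

/-!
# Junta fields on the slice: low-degree Gram factorisations, uniformly in the matrix size

Topic `Literature/Combinatorics/Optimization`; a corollary file (theorems only, 0 facts) of
`HypercubeSosUpperBounds.lean` (Fawzi–Saunderson–Parrilo 2016 Thm 2 / the Sakaue–Takeda–Kim–Ito 2017 bound
`⌈(m+d−1)/2⌉`, scalar and matrix-valued) and `KnapsackQuadraticSosDegree.lean` Part IV (the pull-back of
cube degree to Filmus's slice degree along `U ↦ z_A(U)`, `z_A(U)_i = [a_i ∈ U]`,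
`hasDegreeLEOn_comp_restrictToCoords`), written in the vocabulary the `pnp-psdrank` bricks consume
(`IsLowDegreeU n k B`: every entry of `U ↦ B_U` lies in the span of the containment indicators
`1[A' ⊆ U]`, `|A'| ≤ k`, `TracialDesignsLowDegree.lean`).

* `mem_span_containment_of_hasDegreeLEOn` — Filmus slice degree `≤ k` on all sets ⇒ the restriction to odd
  cuts lies in the bricks' span (the bookkeeping inside `isLowDegreeU_gram_interFallingQuadratic`, isolated).
* `sliceSos_of_junta` — for every nonnegative `q : {0,1}^{|A|} → ℝ` of degree `≤ d` and every domain `𝒟`: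
  `U ↦ q(z_A(U))` is a sum of squares of functions of Johnson degree `≤ ⌈(|A|+d−1)/2⌉` on `𝒟`
  (`d = 2`, `q = f_k`: `sliceSos_interFallingQuadratic`).
* `isLowDegreeU_gram_of_juntaField` — **r-uniform matrix form**: for every pointwise-psd
  `F : {0,1}^{|A|} → ℝ^{r×r}` with entries of degree `≤ d`, the `A`-junta field `X_U = F(z_A(U))` on the
  odd cuts has a Gram factorisation `X_U = B_U B_Uᵀ` with `IsLowDegreeU n ⌈(|A|+d−1)/2⌉ B` — whatever the
  dimension `r` (matrix Sakaue–Takeda–Kim–Ito pulled back to the slice).  With `d = 2` and quadratic FORMS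
  in the `±1` coordinates of `z_A(U)` the degree is `⌈|A|/2⌉` (`isLowDegreeU_gram_of_juntaField_even`).

Everything is PROVED; the matrix-valued cube statements are our reading of the (scalar) sources, proved in
`HypercubeSosUpperBounds.lean` Part V.

## References

* [FawziSaundersonParrilo2016] H. Fawzi, J. Saunderson, P. A. Parrilo, Math. Program. 160 (2016) — Thm 2
  (p. 3), Thm 1/§3, App. B; proved in `HypercubeSosUpperBounds.lean`.
* [SakaueEtAl2017] S. Sakaue, A. Takeda, S. Kim, N. Ito, SIAM J. Optim. 27 (2017) 565–582 — the bound
  `⌈(m+r−1)/2⌉` as quoted in [KurpiszLeppanenMastrolilli2016] §1 p. 3; proved ibid.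
* [FilmusIhringer2019] Y. Filmus, F. Ihringer, §2 (p. 4) — degree on a domain of the slice
  (`SliceFKN.HasDegreeLEOn`).
* [LeeRaghavendraSteurer2015] J. R. Lee, P. Raghavendra, D. Steurer, STOC 2015, §5 — matrix-valued
  low-degree functions (`IsLowDegreeU`).
-/

noncomputable section

open Finset Matrix
open Literature.Combinatorics.AssociationSchemes (JohnsonHarmonics.zeta JohnsonHarmonics.zeta_apply
  SliceFKN.HasDegreeLEOn)
open Literature.Barriers.PneNP (OddSet)

namespace Literature.Combinatorics.Optimization

variable {n : ℕ}

/-- **Slice degree on all sets ⇒ the bricks' span.**  If `g` has Johnson degree `≤ k` on the domain of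
ALL subsets (Filmus: `g = Σ_{|S| ≤ k} v_S 1[S ⊆ ·]`), then its restriction to the odd cuts lies in the real
span of the containment indicators `1[A' ⊆ U]`, `|A'| ≤ k`.
[cite: FilmusIhringer2019, §2 (p. 4: degree on a domain)] [cite: LeeRaghavendraSteurer2015, §5 (low-degree matrix-valued functions)] -/
theorem mem_span_containment_of_hasDegreeLEOn {k : ℕ} {g : Finset (Fin n) → ℝ}
    (hg : SliceFKN.HasDegreeLEOn (univ : Finset (Finset (Fin n))) k g) :
    (fun U : OddSet n => g U.1) ∈
      Submodule.span ℝ (Set.range fun A' : {A' : Finset (Fin n) // A'.card ≤ k} =>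
        fun U : OddSet n => if A'.1 ⊆ U.1 then (1 : ℝ) else 0) := by
  classical
  obtain ⟨v, hv, hvg⟩ := hg
  have hfun : (fun U : OddSet n => g U.1) =
      ∑ T ∈ univ.filter (fun T : Finset (Fin n) => T.card ≤ k),
        v T • (fun U : OddSet n => if T ⊆ U.1 then (1 : ℝ) else 0) := by
    funext U
    rw [hvg U.1 (mem_univ _), JohnsonHarmonics.zeta_apply, Finset.sum_apply]
    simp only [Pi.smul_apply, smul_eq_mul, mul_ite, mul_one, mul_zero]
    rw [← sum_filter]
    calc ∑ T ∈ U.1.powerset, v T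
        = ∑ T ∈ U.1.powerset.filter (fun T => T.card ≤ k), v T := by
          rw [← sum_filter_add_sum_filter_not U.1.powerset (fun T => T.card ≤ k), add_eq_left]
          exact sum_eq_zero fun T hT => hv T (not_le.1 (mem_filter.1 hT).2)
      _ = _ := by
          congr 1
          ext T
          simp [mem_powerset, and_comm]
  rw [hfun]
  refine Submodule.sum_mem _ fun T hT => Submodule.smul_mem _ _ (Submodule.subset_span ?_)
  exact ⟨⟨T, (mem_filter.1 hT).2⟩, rfl⟩

/-- **Nonnegative junta functions on the slice are sums of squares of Johnson degree `⌈(|A|+d−1)/2⌉`.**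
For `A ⊆ [n]`, a nonnegative `q : {0,1}^{|A|} → ℝ` of degree `≤ d` and any domain `𝒟` of subsets:
`q(z_A(U)) = Σ_j h_j(U)²` on `𝒟` with all `h_j` of Johnson degree `≤ (|A|+d)/2` on `𝒟` — the
Sakaue–Takeda–Kim–Ito certificate on `{0,1}^{|A|}` pulled back along `U ↦ z_A(U)`.
[cite: SakaueEtAl2017, main theorem (as quoted in KurpiszLeppanenMastrolilli2016 §1 p. 3)] [cite: FilmusIhringer2019, §2 (p. 4)] -/
theorem sliceSos_of_junta (A : Finset (Fin n)) {d : ℕ} (q : (Fin A.card → Bool) → ℝ)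
    (hq : ∀ z, 0 ≤ q z) (hdeg : HasDegreeLE d q) (𝒟 : Finset (Finset (Fin n))) :
    ∃ (J : ℕ) (h : Fin J → Finset (Fin n) → ℝ),
      (∀ j, SliceFKN.HasDegreeLEOn 𝒟 ((A.card + d) / 2) (h j)) ∧
      ∀ U ∈ 𝒟, q (fun i : Fin A.card => decide (A.orderEmbOfFin rfl i ∈ U)) = ∑ j, h j U ^ 2 := by
  obtain ⟨J, g, hg, hsq⟩ := hasSosCertificate_of_nonneg_of_hasDegreeLE q hq hdeg
  refine ⟨J, fun j U => g j (fun i : Fin A.card => decide (A.orderEmbOfFin rfl i ∈ U)),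
    fun j => hasDegreeLEOn_comp_restrictToCoords A ?_ 𝒟, fun U _ => hsq _⟩
  have : 2 * ((A.card + d) / 2) / 2 = (A.card + d) / 2 := by omega
  simpa [this] using hg j

/-- **Junta psd fields on the slice have low-degree Gram factorisations, uniformly in the matrix size.**
For `A ⊆ [n]` and a pointwise positive-semidefinite `F : {0,1}^{|A|} → ℝ^{r×r}` whose entries have degree
`≤ d`, the field `X_U = F(z_A(U))` on the odd cuts factors as `X_U = B_U B_Uᵀ` with
`IsLowDegreeU n ((|A|+d)/2) B` (every entry of `B_U` in the span of `1[A' ⊆ U]`, `|A'| ≤ ⌈(|A|+d−1)/2⌉`) —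
for EVERY `r` (matrix Sakaue–Takeda–Kim–Ito, `gramFactorization_of_psd_of_hasDegreeLE`, pulled back).
[cite: SakaueEtAl2017, main theorem (as quoted in KurpiszLeppanenMastrolilli2016 §1 p. 3) — matrix-valued reading (ours)] [cite: LeeRaghavendraSteurer2015, §5 (low-degree matrix-valued functions)] [cite: FilmusIhringer2019, §2 (p. 4)] -/
theorem isLowDegreeU_gram_of_juntaField (A : Finset (Fin n)) {r d : ℕ}
    (F : (Fin A.card → Bool) → Matrix (Fin r) (Fin r) ℝ) (hF : ∀ z, (F z).PosSemidef)
    (hdeg : ∀ a b, HasDegreeLE d (fun z => F z a b)) :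
    ∃ (J : ℕ) (B : OddSet n → Matrix (Fin r) (Fin J) ℝ), IsLowDegreeU n ((A.card + d) / 2) B ∧
      ∀ U : OddSet n, F (fun i : Fin A.card => decide (A.orderEmbOfFin rfl i ∈ U.1)) = B U * (B U)ᵀ := by
  obtain ⟨J, G, hG, hFG⟩ := gramFactorization_of_psd_of_hasDegreeLE F hF hdeg
  refine ⟨J, fun U => G (fun i : Fin A.card => decide (A.orderEmbOfFin rfl i ∈ U.1)), fun a j => ?_,
    fun U => hFG _⟩
  exact mem_span_containment_of_hasDegreeLEOn (hasDegreeLEOn_comp_restrictToCoords A (hG a j) univ)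

/-- **The quadratic-form case, degree `⌈|A|/2⌉`.**  If every entry of the pointwise-psd
`F : {0,1}^{|A|} → ℝ^{r×r}` is a quadratic form in the `±1` coordinates (Fourier support in
`{|S| ∈ {0, 2}}`), the junta field `X_U = F(z_A(U))` has a Gram factor with `IsLowDegreeU n ((|A|+1)/2)`
(matrix Laurent/Fawzi–Saunderson–Parrilo, `gramFactorization_of_psd_even_quadratic`, pulled back).
[cite: FawziSaundersonParrilo2016, Thm 2 (p. 3) — matrix-valued reading (ours)] [cite: LeeRaghavendraSteurer2015, §5] -/
theorem isLowDegreeU_gram_of_juntaField_even (A : Finset (Fin n)) {r : ℕ}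
    (F : (Fin A.card → Bool) → Matrix (Fin r) (Fin r) ℝ) (hF : ∀ z, (F z).PosSemidef)
    (hsupp : ∀ a b (S : Finset (Fin A.card)),
      Literature.Computability.Complexity.LowDegree.cubeFourierCoeff (fun z => F z a b) S ≠ 0 →
        S.card = 0 ∨ S.card = 2) :
    ∃ (J : ℕ) (B : OddSet n → Matrix (Fin r) (Fin J) ℝ), IsLowDegreeU n ((A.card + 1) / 2) B ∧
      ∀ U : OddSet n, F (fun i : Fin A.card => decide (A.orderEmbOfFin rfl i ∈ U.1)) = B U * (B U)ᵀ := by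
  obtain ⟨J, G, hG, hFG⟩ := gramFactorization_of_psd_even_quadratic F hF hsupp
  refine ⟨J, fun U => G (fun i : Fin A.card => decide (A.orderEmbOfFin rfl i ∈ U.1)), fun a j => ?_,
    fun U => hFG _⟩
  exact mem_span_containment_of_hasDegreeLEOn (hasDegreeLEOn_comp_restrictToCoords A (hG a j) univ)

end Literature.Combinatorics.Optimization
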